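import Mathlib
import Summits.ResolutionOfSingularities.ResolutionOfSingularities.Theorems.HomologicalConductorPersistencePointedCyclesTree
import HarnessLib

/-!
# Rung S-2 `PersistenceSurface` (stmt-ResolutionOfSingularities-19970) — POINTED CYCLES VI-b: Thm 12.1 for an honest TREE
# (`SimpleGraph.IsTree`): the distance to `t` is a rooted orientation (K-PCC §12; res-L1-w44b-stub-1 g6, K6)

Route `ResolutionOfSingularities/HomologicalConductor`, chain W4.4b, rung S-2 `PersistenceSurface` (stmt-19970), stub C3′ /
C2.  `[OURS · L1 w44b]`; replaces the role of no printed item; NOT a statement of the manuscript under review (Hironaka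
2017); AI-written elementary graph / lattice arithmetic, weaker than expert review.  Def-free sequel of
`…PersistencePointedCyclesTree` (`eq_zero_of_isPointedAlmostNef_of_rooted`: Thm 12.1 under an abstract rooted orientation).

* `exists_parent_of_isAcyclic` — in a connected acyclic simple graph, every `v ≠ t` has a neighbour `p` (the penultimate
  vertex of the shortest path from `t`) such that every OTHER neighbour of `v` is strictly farther from `t`
  (Mathlib: `IsAcyclic.path_concat`, `IsAcyclic.path_unique`, `Connected.exists_path_of_dist`);
* **`eq_zero_of_isPointedAlmostNef_of_isTree`** — K-PCC Thm 12.1 verbatim for the dual graph: `G` a tree on `ι` whose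
  edges contain the off-diagonal support of `M` (`M i j ≠ 0 → G.Adj i j`), `0 ≤ M i j ≤ 1` off the diagonal, `M i i ≤ −2`,
  `∑ j, M j i ≤ 0` (`b_v ≥ max(2, val_v)`) ⇒ every effective cycle almost nef at `t` is `0` (`𝒜_t = {0}`, NP at every
  curve); `greatest_eq_zero_of_isTree` — the NP(t) shape (`A⁽ᵗ⁾ = 0`).

References (mechanism only): this work (memo K-PCC v7 §12, res-L1-w44b-lead-1); J. Lipman, Publ. IHÉS 36 (1969) §18
[`Lipman1969`].
-/

-- single-problem summit: the doubled namespace component `ResolutionOfSingularities` is forced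
set_option linter.dupNamespace false

namespace Summit.ResolutionOfSingularities.ResolutionOfSingularities.Theorems.HomologicalConductor.PersistencePointedCyclesTree

open Finset

variable {ι : Type*} [Fintype ι] [DecidableEq ι]

omit [Fintype ι] [DecidableEq ι] in
/-- **The distance to `t` orients a tree.** In a connected acyclic simple graph, every vertex `v ≠ t` has a neighbour `p`
— the penultimate vertex of the (unique) shortest path from `t` to `v` — such that every other neighbour `w` of `v` is
strictly farther from `t` than `v` (indeed `dist(w,t) = dist(v,t) + 1`: the shortest path to `w` passes through `v`).
[folklore] -/
theorem exists_parent_of_isAcyclic (G : SimpleGraph ι) (hconn : G.Connected) (hacyc : G.IsAcyclic) (t v : ι) :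
    ∃ p, ∀ w, w ≠ v → w ≠ p → G.Adj w v → G.dist v t < G.dist w t := by
  obtain ⟨q, hq, hqlen⟩ := hconn.exists_path_of_dist t v
  refine ⟨q.penultimate, fun w _ hwp hadj => ?_⟩
  obtain ⟨r, hr, hrlen⟩ := hconn.exists_path_of_dist t w
  by_cases hvr : v ∈ r.support
  · -- the shortest path to `w` is the one to `v` followed by the edge `v w`
    have h := hacyc.path_concat hq hr hadj.symm hvr
    have hlen : r.length = q.length + 1 := by rw [h, SimpleGraph.Walk.length_concat]
    rw [SimpleGraph.dist_comm (u := v), SimpleGraph.dist_comm (u := w), ← hqlen, ← hrlen, hlen]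
    exact Nat.lt_succ_self _
  · -- otherwise the path to `w` extended by the edge `w v` IS the path to `v`, so `w` is its penultimate vertex
    have hpath : (r.concat hadj).IsPath := hr.concat hvr hadj
    have heq : q = r.concat hadj := Subtype.mk.inj (hacyc.path_unique ⟨q, hq⟩ ⟨r.concat hadj, hpath⟩)
    have hpen : q.penultimate = w := by rw [heq, SimpleGraph.Walk.penultimate_concat]
    exact absurd hpen.symm hwp

/-- **K-PCC Thm 12.1 for a TREE** (memo v7 §12): let `G` be a tree on `ι` (connected, acyclic) containing the off-diagonal
support of `M` (`M i j ≠ 0 → G.Adj i j` for `i ≠ j`), with `0 ≤ M i j ≤ 1` off the diagonal, `M i i ≤ −2` and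
`∑ j, M j i ≤ 0` for every `i` (`b_v ≥ max(2, val_v)`: all minimal resolution graphs of reduced-`Z_f` rational surface
singularities, all Hirzebruch–Jung chains, all `A_ℓ`-paths).  Then for every `t`, every effective cycle `A` with
`A·C_i ≥ −δ_it` for all `i` is ZERO — NP holds at every curve. [this work] -/
theorem eq_zero_of_isPointedAlmostNef_of_isTree (G : SimpleGraph ι) (hG : G.IsTree) (M : ι → ι → ℤ)
    (hsupp : ∀ i j, i ≠ j → M i j ≠ 0 → G.Adj i j) (hoff : ∀ i j, i ≠ j → 0 ≤ M i j)
    (hmult : ∀ i j, i ≠ j → M i j ≤ 1) (hdiag : ∀ i, M i i ≤ -2) (hrow : ∀ i, ∑ j, M j i ≤ 0) (t : ι) (A : ι → ℕ)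
    (hA : ∀ i, -(if i = t then (1 : ℤ) else 0) ≤ ∑ j, (A j : ℤ) * M j i) : A = 0 := by
  refine eq_zero_of_isPointedAlmostNef_of_rooted M hoff hmult hdiag hrow t (fun v => G.dist v t) ?_ ?_ A hA
  · intro w hw _
    rw [SimpleGraph.dist_self]
    exact hG.connected.pos_dist_of_ne hw
  · intro v hv
    obtain ⟨p, hp⟩ := exists_parent_of_isAcyclic G hG.connected hG.isAcyclic t v
    exact ⟨p, fun w hwv hwp hM => hp w hwv hwp (hsupp w v hwv hM)⟩

/-- **NP(t) on a tree, greatest-element form**: under the hypotheses of Thm 12.1 any greatest element `A₀` of `𝒜_t` (the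
memo's `A⁽ᵗ⁾`) is `0`, so the pointed ceiling reads `ca³(T) ⊆ I(Z⁽ᵗ⁾)` at every curve. [this work] -/
theorem greatest_eq_zero_of_isTree (G : SimpleGraph ι) (hG : G.IsTree) (M : ι → ι → ℤ)
    (hsupp : ∀ i j, i ≠ j → M i j ≠ 0 → G.Adj i j) (hoff : ∀ i j, i ≠ j → 0 ≤ M i j)
    (hmult : ∀ i j, i ≠ j → M i j ≤ 1) (hdiag : ∀ i, M i i ≤ -2) (hrow : ∀ i, ∑ j, M j i ≤ 0) (t : ι) (A₀ : ι → ℕ)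
    (hA₀ : IsGreatest {A : ι → ℕ | ∀ i, -(if i = t then (1 : ℤ) else 0) ≤ ∑ j, (A j : ℤ) * M j i} A₀) : A₀ = 0 :=
  eq_zero_of_isPointedAlmostNef_of_isTree G hG M hsupp hoff hmult hdiag hrow t A₀ hA₀.1

/-- Pointwise form on a tree: every almost-nef-at-`t` effective cycle vanishes at every curve. [this work] -/
theorem forall_eq_zero_of_isPointedAlmostNef_of_isTree (G : SimpleGraph ι) (hG : G.IsTree) (M : ι → ι → ℤ)
    (hsupp : ∀ i j, i ≠ j → M i j ≠ 0 → G.Adj i j) (hoff : ∀ i j, i ≠ j → 0 ≤ M i j)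
    (hmult : ∀ i j, i ≠ j → M i j ≤ 1) (hdiag : ∀ i, M i i ≤ -2) (hrow : ∀ i, ∑ j, M j i ≤ 0) (t : ι) (A : ι → ℕ)
    (hA : ∀ i, -(if i = t then (1 : ℤ) else 0) ≤ ∑ j, (A j : ℤ) * M j i) (i : ι) : A i = 0 := by
  rw [eq_zero_of_isPointedAlmostNef_of_isTree G hG M hsupp hoff hmult hdiag hrow t A hA]
  rfl

end Summit.ResolutionOfSingularities.ResolutionOfSingularities.Theorems.HomologicalConductor.PersistencePointedCyclesTree
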